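import Summits.ValiantsHypothesis.ValiantsHypothesis.Theorems.BarrierLeverChowHitsPartitionMinorsRFacePrivateLeading

/-!
# Route BarrierLever — item `ChowHitsPartitionMinorsR` (stmt-ValiantsHypothesis-21882):
# THEOREM H (hybrid design), file 2 — THE LEADING MATRIX OF THE HYBRID DESIGN IS NONSINGULAR

Helper file (`--supports stmt-ValiantsHypothesis-21882`; cell valiant-natproofs, rung V4, 𝒟-side support item of route
BarrierLever; prover seat val-np-p5 gen 32; seat memo MEMO-21882-valnp5-g32.md §6 «THEOREM H», kernel steps K-H4/K-H5). Closes
NO item. Companion of `…ChowHitsPartitionMinorsRFacePrivateLeading` (p712585 chain, THEOREM FP), whose truncated-inverse and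
triangularity lemmas it reuses.

THE MATRIX. Rows `u : Fin r → Finset (Fin h)` injective with lower-set range; columns `w`; a permutation `σ` of the indices
labelling every COMMON column (`w j` a row, predicate `z j`) by its row (`u (σ j) = w j`) and every DEFECT column `j` (`¬ z j`)
by some row `u (σ j)`; exponents `n j ≥ 1` on the defect columns; pure parts `Q_j = (1 − X_{u(σ j)})^{n j}`, `Q = ∏_{defect} Q_j`.
The leading matrix of the hybrid design (memo §6, step (4) with the size-graded scaling) is
  `A[i, j] = (−1)^{|w j|} · [w j ⊆ u i] · coeff_{x^{u i ∖ w j}} Q`        (common columns),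
  `A[i, j] = coeff_{x^{u i}} ∏_{defect j' ≠ j} Q_{j'}`                     (defect columns).
**`det_leadingHybrid_ne_zero`: `det A ≠ 0`.** Proof: `A = M_Q · T` with `M_Q[i,k] = [u k ⊆ u i] coeff_{x^{u i∖u k}} Q`
(lower triangular along `⊆`, diagonal `Q(0) = 1`) and `T[k, j] = (−1)^{|w j|}[k = σ j]` (common) / `coeff_{x^{u k}}` of the
truncated inverse of `Q_j` (defect) — upper triangular along `⊆` through `σ` with nonzero diagonal.

WHAT THIS IS NOT: THEOREM H is assembled in the last file of the chain; nothing here on item 21882's truth, crux 14610 or `VP ≠ VNP`.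
-/

set_option linter.dupNamespace false

namespace Summit.ValiantsHypothesis.ValiantsHypothesis.Theorems.BarrierLever.ChowHybrid

open Finset MvPolynomial
open Summit.ValiantsHypothesis.ValiantsHypothesis.Theorems.BarrierLever.BiadditiveDoor (coeff_partitionExpo_mul)
open Summit.ValiantsHypothesis.ValiantsHypothesis.Theorems.BarrierLever.ChowFacePrivate
  (coeff_partitionExpo_truncInv coeff_partitionExpo_mul_oneSubSumX_pow_mul_truncInv
    det_ne_zero_of_lowerTriangular_subset det_ne_zero_of_upperTriangular_subset sum_powerset_eq_sum_rows)

noncomputable section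

variable {h : ℕ}

/-- **THE LEADING MATRIX OF THE HYBRID DESIGN IS NONSINGULAR.** -/
theorem det_leadingHybrid_ne_zero {r : ℕ} (u w : Fin r → Finset (Fin h)) (hu : Function.Injective u)
    (hlow : ∀ i S, S ⊆ u i → ∃ k, u k = S) (σ : Equiv.Perm (Fin r)) (z : Fin r → Prop) [DecidablePred z]
    (hz : ∀ j, z j → u (σ j) = w j) (n : Fin r → ℕ) (hn : ∀ j, ¬ z j → n j ≠ 0) :
    (Matrix.of fun i j : Fin r =>
      if z j then
        (-1 : ℂ) ^ (w j).card * (if w j ⊆ u i then coeff (∑ a ∈ u i \ w j, Finsupp.single (Fin.castAdd h a) 1 +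
          ∑ c ∈ (∅ : Finset (Fin h)), Finsupp.single (Fin.natAdd h c) 1)
          (∏ j' ∈ (Finset.univ : Finset (Fin r)).filter (fun j' => ¬ z j'),
            ((1 + C (-1 : ℂ) * ∑ a ∈ u (σ j'), X (Fin.castAdd h a)) ^ (n j') : MvPolynomial (Fin (h + h)) ℂ)) else 0)
      else coeff (∑ a ∈ u i, Finsupp.single (Fin.castAdd h a) 1 +
          ∑ c ∈ (∅ : Finset (Fin h)), Finsupp.single (Fin.natAdd h c) 1)
        (∏ j' ∈ ((Finset.univ : Finset (Fin r)).filter (fun j' => ¬ z j')).erase j,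
          ((1 + C (-1 : ℂ) * ∑ a ∈ u (σ j'), X (Fin.castAdd h a)) ^ (n j') : MvPolynomial (Fin (h + h)) ℂ))).det ≠ 0 := by
  classical
  set Ef : Finset (Fin r) := (Finset.univ : Finset (Fin r)).filter (fun j' => ¬ z j') with hEf
  set Q : Fin r → MvPolynomial (Fin (h + h)) ℂ := fun j' =>
    (1 + C (-1 : ℂ) * ∑ a ∈ u (σ j'), X (Fin.castAdd h a)) ^ (n j') with hQdef
  set Qall : MvPolynomial (Fin (h + h)) ℂ := ∏ j' ∈ Ef, Q j' with hQall
  -- the truncated inverses (defect columns only)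
  set Tr : Fin r → MvPolynomial (Fin (h + h)) ℂ := fun j =>
    ∑ i ∈ Finset.range ((u (σ j)).card + 1), C (((((n j - 1) + i).choose (n j - 1) : ℕ) : ℂ)) *
      (∑ a ∈ u (σ j), X (Fin.castAdd h a)) ^ i with hTr
  -- Step A: for a defect column, `coeff_{x^U} ∏_{Ef ∖ j} Q = coeff_{x^U} (Tr j * Qall)`
  have stepA : ∀ (j : Fin r), ¬ z j → ∀ (U : Finset (Fin h)),
      coeff (∑ a ∈ U, Finsupp.single (Fin.castAdd h a) 1 +
          ∑ c ∈ (∅ : Finset (Fin h)), Finsupp.single (Fin.natAdd h c) 1) (∏ j' ∈ Ef.erase j, Q j') =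
      coeff (∑ a ∈ U, Finsupp.single (Fin.castAdd h a) 1 +
          ∑ c ∈ (∅ : Finset (Fin h)), Finsupp.single (Fin.natAdd h c) 1) (Tr j * Qall) := by
    intro j hj U
    have hjE : j ∈ Ef := Finset.mem_filter.mpr ⟨Finset.mem_univ _, hj⟩
    obtain ⟨d, hd⟩ := Nat.exists_eq_succ_of_ne_zero (hn j hj)
    have hQj : Q j = (1 + C (-1 : ℂ) * ∑ a ∈ u (σ j), X (Fin.castAdd h a)) ^ (d + 1) := by
      simp only [hQdef, hd]
    have hsplit : Qall = (∏ j' ∈ Ef.erase j, Q j') * Q j := by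
      rw [hQall, Finset.prod_erase_mul _ _ hjE]
    rw [hTr]
    dsimp only
    rw [show n j - 1 = d by omega, mul_comm, hsplit, mul_assoc, hQj]
    exact (coeff_partitionExpo_mul_oneSubSumX_pow_mul_truncInv _ _ _ _ _).symm
  -- square-free coefficients of the truncated inverses
  have hTrcoeff : ∀ (j : Fin r) (S : Finset (Fin h)),
      coeff (∑ a ∈ S, Finsupp.single (Fin.castAdd h a) 1 +
          ∑ c ∈ (∅ : Finset (Fin h)), Finsupp.single (Fin.natAdd h c) 1) (Tr j) =
      if S ⊆ u (σ j) then (((((n j - 1) + S.card).choose (n j - 1)) * S.card.factorial : ℕ) : ℂ)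
      else 0 := by
    intro j S
    rw [hTr]
    dsimp only
    rw [coeff_partitionExpo_truncInv]
    by_cases hS : S ⊆ u (σ j)
    · rw [if_pos ⟨rfl, hS, Finset.card_le_card hS⟩, if_pos hS]
    · rw [if_neg (fun hh => hS hh.2.1), if_neg hS]
  -- the factorisation `A = M_Q · T`
  set Mq : Matrix (Fin r) (Fin r) ℂ := Matrix.of fun i k =>
    if u k ⊆ u i then coeff (∑ a ∈ u i \ u k, Finsupp.single (Fin.castAdd h a) 1 +
      ∑ c ∈ (∅ : Finset (Fin h)), Finsupp.single (Fin.natAdd h c) 1) Qall else 0 with hMq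
  set Tm : Matrix (Fin r) (Fin r) ℂ := Matrix.of fun k j =>
    if z j then (if k = σ j then (-1 : ℂ) ^ (w j).card else 0)
    else coeff (∑ a ∈ u k, Finsupp.single (Fin.castAdd h a) 1 +
      ∑ c ∈ (∅ : Finset (Fin h)), Finsupp.single (Fin.natAdd h c) 1) (Tr j) with hTm
  have hfac : (Matrix.of fun i j : Fin r =>
      if z j then
        (-1 : ℂ) ^ (w j).card * (if w j ⊆ u i then coeff (∑ a ∈ u i \ w j, Finsupp.single (Fin.castAdd h a) 1 +
          ∑ c ∈ (∅ : Finset (Fin h)), Finsupp.single (Fin.natAdd h c) 1) Qall else 0)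
      else coeff (∑ a ∈ u i, Finsupp.single (Fin.castAdd h a) 1 +
          ∑ c ∈ (∅ : Finset (Fin h)), Finsupp.single (Fin.natAdd h c) 1) (∏ j' ∈ Ef.erase j, Q j')) = Mq * Tm := by
    ext i j
    rw [Matrix.of_apply, Matrix.mul_apply]
    by_cases hzj : z j
    · -- common column: only `k = σ j` contributes
      rw [if_pos hzj, Finset.sum_eq_single (σ j)]
      · rw [hMq, hTm, Matrix.of_apply, Matrix.of_apply, if_pos hzj, if_pos rfl, hz j hzj, mul_comm]
      · intro k _ hk
        rw [hTm, Matrix.of_apply, if_pos hzj, if_neg hk, mul_zero]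
      · intro hk; exact absurd (Finset.mem_univ _) hk
    · rw [if_neg hzj, stepA j hzj (u i), coeff_partitionExpo_mul]
      simp only [Finset.powerset_empty, Finset.sum_singleton, Finset.sdiff_self]
      rw [sum_powerset_eq_sum_rows u hu hlow i]
      refine Finset.sum_congr rfl fun k _ => ?_
      rw [hMq, hTm, Matrix.of_apply, Matrix.of_apply, if_neg hzj]
      by_cases hk : u k ⊆ u i
      · rw [if_pos hk, if_pos hk, mul_comm]
      · rw [if_neg hk, if_neg hk, zero_mul]
  rw [hfac, Matrix.det_mul]
  refine mul_ne_zero ?_ ?_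
  · -- `M_Q` is lower triangular along `⊆` with diagonal `Qall(0) = 1`
    refine det_ne_zero_of_lowerTriangular_subset u hu Mq (fun i k hik => ?_) (fun i => ?_)
    · by_contra hsub
      rw [hMq, Matrix.of_apply, if_neg hsub] at hik
      exact hik rfl
    · rw [hMq, Matrix.of_apply, if_pos (subset_refl _), Finset.sdiff_self,
        Finset.sum_empty, Finset.sum_empty, add_zero, ← MvPolynomial.constantCoeff_eq, hQall, map_prod]
      rw [Finset.prod_eq_one]
      · exact one_ne_zero
      · intro j' _
        rw [hQdef]
        simp only [map_pow, map_add, map_one, map_mul, constantCoeff_C, map_sum, constantCoeff_X,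
          Finset.sum_const_zero, mul_zero, add_zero, one_pow]
  · -- `T` is upper triangular along `⊆` through `σ`, nonzero diagonal
    refine det_ne_zero_of_upperTriangular_subset u hu σ Tm (fun k j hkj => ?_) (fun j => ?_)
    · by_cases hzj : z j
      · rw [hTm, Matrix.of_apply, if_pos hzj] at hkj
        by_cases hk : k = σ j
        · rw [hk]
        · rw [if_neg hk] at hkj; exact absurd rfl hkj
      · by_contra hsub
        rw [hTm, Matrix.of_apply, if_neg hzj, hTrcoeff, if_neg hsub] at hkj
        exact hkj rfl
    · by_cases hzj : z j
      · rw [hTm, Matrix.of_apply, if_pos hzj, if_pos rfl]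
        exact pow_ne_zero _ (neg_ne_zero.mpr one_ne_zero)
      · rw [hTm, Matrix.of_apply, if_neg hzj, hTrcoeff, if_pos (subset_refl _), Nat.cast_ne_zero]
        exact Nat.mul_ne_zero (Nat.choose_pos (by omega)).ne' (Nat.factorial_ne_zero _)

end

end Summit.ValiantsHypothesis.ValiantsHypothesis.Theorems.BarrierLever.ChowHybrid
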